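import Literature.Topology.FourManifolds.StandardTrisectionSlotSymmetry
import Summits.SmoothPoincare4.SmoothPoincare4.Theorems.AgkCor6Sufficiency.Negative.AnyGroupFalse

/-!
# `NormalFormStablyTrivial` — negative-side support Ia: `zKernels` is in Waldhausen normal form

Refuter support file (cdisprove seat) for crux item stmt-SmoothPoincare4-14591
(`CongruenceShadows.NormalFormStablyTrivial`).  The `(3;1,1,1)` trisection
`zKernels = (⟪a₀,a₁,a₂⟫, ⟪a₀,b₁,b₂⟫, ⟪a₀,a₁b₁,a₂b₂⟫)` of `S¹×S³ # ℂP² # ℂP²` (sibling file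
`AgkCor6Sufficiency/Negative/AnyGroupFalse.lean`; `χ = 2`, `π₁ = ℤ`, not stably trivial) satisfies
the normal-form hypothesis of the crux at `m = 0`: EACH ORDERED PAIR `(Z_i, Z_j)` is the image of the
standard pair `(N_i, N_j)` of the genus-3 trisection of `S⁴` under ONE automorphism of `S_3`
(`pairs_zKernels`).  The automorphisms are explicit: three relator-fixing LOCAL automorphisms
(`rot2` = half-twist `a₂ ↦ b₂⁻¹, b₂ ↦ b₂a₂b₂⁻¹`; `aut02` = `T_{a₁}` on handle 1 and `T_{a₂}ρ₂` on
handle 2; `aut12` = `ρ₁T_{a₁}⁻¹` on handle 1 and `T_{b₂}` on handle 2; every identity checked by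
`decide` in the free group `F_6`, packaged as `RelatorAut 3`) composed with the slot symmetries
`cyc`, `swp` of the standard triple (`StandardTrisectionSlotSymmetry.lean`).  Used by
`TripleLoadBearing.lean` (`π₁ = 1` is load-bearing for the crux).  Everything is proved; nothing
here concludes a Theses statement.

References: D. Gay, R. Kirby, *Trisecting 4-manifolds*, Geom. Topol. 20 (2016), §2 (genus-one
trisections of `S¹×S³`, `ℂP²`, connected sums); F. Waldhausen, *Heegaard-Zerlegungen der
3-Sphäre*, Topology 7 (1968) (genus-`g` splittings of `S¹×S²`, `S³` are standard — the geometric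
reason these automorphisms exist); A. Abrams, D. Gay, R. Kirby, Geom. Topol. 22 (2018), §2.
-/

-- the prescribed namespace `Summit.<P>.<Sub>.…` duplicates `SmoothPoincare4` (P = Sub)
set_option linter.dupNamespace false

noncomputable section

namespace Summit.SmoothPoincare4.SmoothPoincare4.Theorems.NormalFormStablyTrivial.Negative

open Literature.Topology.FourManifolds Subgroup RelatorAut
open Summit.SmoothPoincare4.SmoothPoincare4.Theorems.AgkCor6Sufficiency.Negative
  (za zb zKernels zKernels_zero zKernels_one zKernels_two)

/-! ### Three relator-fixing LOCAL automorphisms of `S_3` (products of half-twists and Dehn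
twists on handles 1, 2; handle 0 fixed) -/

/-- `ρ₂` (half-twist on handle 2): `a₂ ↦ b₂⁻¹`, `b₂ ↦ b₂ a₂ b₂⁻¹`. [folklore] -/
def rot2Gen (x : surfaceGen 3) : FreeGroup (surfaceGen 3) :=
  if x = (2, false) then (FreeGroup.of (2, true))⁻¹
  else if x = (2, true) then FreeGroup.of (2, true) * FreeGroup.of (2, false) * (FreeGroup.of (2, true))⁻¹
  else FreeGroup.of x

/-- `ρ₂⁻¹`: `a₂ ↦ a₂ b₂ a₂⁻¹`, `b₂ ↦ a₂⁻¹`. [folklore] -/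
def rot2InvGen (x : surfaceGen 3) : FreeGroup (surfaceGen 3) :=
  if x = (2, false) then FreeGroup.of (2, false) * FreeGroup.of (2, true) * (FreeGroup.of (2, false))⁻¹
  else if x = (2, true) then (FreeGroup.of (2, false))⁻¹
  else FreeGroup.of x

/-- `ρ₂` as a relator-fixing automorphism (all identities by `decide` in the free group).
[folklore] -/
def rot2 : RelatorAut 3 :=
  ofGens rot2Gen rot2InvGen (by decide) (by decide) (by decide) (by decide)

/-- `θ` = (`T_{a₁}` on handle 1: `b₁ ↦ b₁ a₁`) · (`T_{a₂} ρ₂` on handle 2: `a₂ ↦ a₂⁻¹ b₂⁻¹`,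
`b₂ ↦ b₂ a₂ b₂⁻¹`). [folklore] -/
def aut02Gen (x : surfaceGen 3) : FreeGroup (surfaceGen 3) :=
  if x = (1, true) then FreeGroup.of (1, true) * FreeGroup.of (1, false)
  else if x = (2, false) then (FreeGroup.of (2, false))⁻¹ * (FreeGroup.of (2, true))⁻¹
  else if x = (2, true) then FreeGroup.of (2, true) * FreeGroup.of (2, false) * (FreeGroup.of (2, true))⁻¹
  else FreeGroup.of x

/-- `θ⁻¹`: `b₁ ↦ b₁ a₁⁻¹`, `a₂ ↦ a₂ b₂ a₂⁻¹`, `b₂ ↦ b₂⁻¹ a₂⁻¹`. [folklore] -/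
def aut02InvGen (x : surfaceGen 3) : FreeGroup (surfaceGen 3) :=
  if x = (1, true) then FreeGroup.of (1, true) * (FreeGroup.of (1, false))⁻¹
  else if x = (2, false) then FreeGroup.of (2, false) * FreeGroup.of (2, true) * (FreeGroup.of (2, false))⁻¹
  else if x = (2, true) then (FreeGroup.of (2, true))⁻¹ * (FreeGroup.of (2, false))⁻¹
  else FreeGroup.of x

/-- `θ` as a relator-fixing automorphism. [folklore] -/
def aut02 : RelatorAut 3 :=
  ofGens aut02Gen aut02InvGen (by decide) (by decide) (by decide) (by decide)

/-- `λ` = (`ρ₁ T_{a₁}⁻¹` on handle 1: `a₁ ↦ b₁⁻¹`, `b₁ ↦ b₁ a₁`) · (`T_{b₂}` on handle 2: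
`a₂ ↦ a₂ b₂`). [folklore] -/
def aut12Gen (x : surfaceGen 3) : FreeGroup (surfaceGen 3) :=
  if x = (1, false) then (FreeGroup.of (1, true))⁻¹
  else if x = (1, true) then FreeGroup.of (1, true) * FreeGroup.of (1, false)
  else if x = (2, false) then FreeGroup.of (2, false) * FreeGroup.of (2, true)
  else FreeGroup.of x

/-- `λ⁻¹`: `a₁ ↦ a₁ b₁`, `b₁ ↦ a₁⁻¹`, `a₂ ↦ a₂ b₂⁻¹`. [folklore] -/
def aut12InvGen (x : surfaceGen 3) : FreeGroup (surfaceGen 3) :=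
  if x = (1, false) then FreeGroup.of (1, false) * FreeGroup.of (1, true)
  else if x = (1, true) then (FreeGroup.of (1, false))⁻¹
  else if x = (2, false) then FreeGroup.of (2, false) * (FreeGroup.of (2, true))⁻¹
  else FreeGroup.of x

/-- `λ` as a relator-fixing automorphism. [folklore] -/
def aut12 : RelatorAut 3 :=
  ofGens aut12Gen aut12InvGen (by decide) (by decide) (by decide) (by decide)

/-- `ofGens` automorphisms on generators. [folklore] -/
theorem ofGens_of (f finv : surfaceGen 3 → FreeGroup (surfaceGen 3)) (h1 h2 h3 h4) (x : surfaceGen 3) :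
    (ofGens f finv h1 h2 h3 h4).toMulEquiv (PresentedGroup.of x) = PresentedGroup.mk _ (f x) := by
  change (ofGens f finv h1 h2 h3 h4).toMulEquiv (PresentedGroup.mk _ (FreeGroup.of x)) = _
  rw [toMulEquiv_mk]
  simp [ofGens]

/-- `ofGens` inverses on generators. [folklore] -/
theorem ofGens_symm_of (f finv : surfaceGen 3 → FreeGroup (surfaceGen 3)) (h1 h2 h3 h4)
    (x : surfaceGen 3) :
    (ofGens f finv h1 h2 h3 h4).toMulEquiv.symm (PresentedGroup.of x) = PresentedGroup.mk _ (finv x) := by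
  change (ofGens f finv h1 h2 h3 h4).toMulEquiv.symm (PresentedGroup.mk _ (FreeGroup.of x)) = _
  rw [toMulEquiv_symm_mk]
  simp [ofGens]

-- generator values (everything as `za i = of (i,false)`, `zb i = of (i,true)`)
/-- `rot2 a₀`. [folklore] -/
theorem rot2_za0 : rot2.toMulEquiv (za 0) = za 0 := by
  rw [rot2, ofGens_of]; simp [rot2Gen, PresentedGroup.of]
/-- `rot2 a₁`. [folklore] -/
theorem rot2_za1 : rot2.toMulEquiv (za 1) = za 1 := by
  rw [rot2, ofGens_of]; simp [rot2Gen, PresentedGroup.of]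
/-- `rot2 b₁`. [folklore] -/
theorem rot2_zb1 : rot2.toMulEquiv (zb 1) = zb 1 := by
  rw [rot2, ofGens_of]; simp [rot2Gen, PresentedGroup.of]
/-- `rot2 a₂`. [folklore] -/
theorem rot2_za2 : rot2.toMulEquiv (za 2) = (zb 2)⁻¹ := by
  rw [rot2, ofGens_of]; simp [rot2Gen, PresentedGroup.of]
/-- `rot2 b₂`. [folklore] -/
theorem rot2_zb2 : rot2.toMulEquiv (zb 2) = zb 2 * za 2 * (zb 2)⁻¹ := by
  rw [rot2, ofGens_of]; simp [rot2Gen, PresentedGroup.of, mul_assoc]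
/-- `rot2⁻¹ a₀`. [folklore] -/
theorem rot2_symm_za0 : rot2.toMulEquiv.symm (za 0) = za 0 := by
  rw [rot2, ofGens_symm_of]; simp [rot2InvGen, PresentedGroup.of]
/-- `rot2⁻¹ a₁`. [folklore] -/
theorem rot2_symm_za1 : rot2.toMulEquiv.symm (za 1) = za 1 := by
  rw [rot2, ofGens_symm_of]; simp [rot2InvGen, PresentedGroup.of]
/-- `rot2⁻¹ b₁`. [folklore] -/
theorem rot2_symm_zb1 : rot2.toMulEquiv.symm (zb 1) = zb 1 := by
  rw [rot2, ofGens_symm_of]; simp [rot2InvGen, PresentedGroup.of]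
/-- `rot2⁻¹ a₂`. [folklore] -/
theorem rot2_symm_za2 : rot2.toMulEquiv.symm (za 2) = za 2 * zb 2 * (za 2)⁻¹ := by
  rw [rot2, ofGens_symm_of]; simp [rot2InvGen, PresentedGroup.of, mul_assoc]
/-- `rot2⁻¹ b₂`. [folklore] -/
theorem rot2_symm_zb2 : rot2.toMulEquiv.symm (zb 2) = (za 2)⁻¹ := by
  rw [rot2, ofGens_symm_of]; simp [rot2InvGen, PresentedGroup.of]

/-- `aut02 a₀`. [folklore] -/
theorem aut02_za0 : aut02.toMulEquiv (za 0) = za 0 := by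
  rw [aut02, ofGens_of]; simp [aut02Gen, PresentedGroup.of]
/-- `aut02 a₁`. [folklore] -/
theorem aut02_za1 : aut02.toMulEquiv (za 1) = za 1 := by
  rw [aut02, ofGens_of]; simp [aut02Gen, PresentedGroup.of]
/-- `aut02 b₁`. [folklore] -/
theorem aut02_zb1 : aut02.toMulEquiv (zb 1) = zb 1 * za 1 := by
  rw [aut02, ofGens_of]; simp [aut02Gen, PresentedGroup.of]
/-- `aut02 a₂`. [folklore] -/
theorem aut02_za2 : aut02.toMulEquiv (za 2) = (za 2)⁻¹ * (zb 2)⁻¹ := by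
  rw [aut02, ofGens_of]; simp [aut02Gen, PresentedGroup.of]
/-- `aut02 b₂`. [folklore] -/
theorem aut02_zb2 : aut02.toMulEquiv (zb 2) = zb 2 * za 2 * (zb 2)⁻¹ := by
  rw [aut02, ofGens_of]; simp [aut02Gen, PresentedGroup.of, mul_assoc]
/-- `aut02⁻¹ a₀`. [folklore] -/
theorem aut02_symm_za0 : aut02.toMulEquiv.symm (za 0) = za 0 := by
  rw [aut02, ofGens_symm_of]; simp [aut02InvGen, PresentedGroup.of]
/-- `aut02⁻¹ a₁`. [folklore] -/
theorem aut02_symm_za1 : aut02.toMulEquiv.symm (za 1) = za 1 := by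
  rw [aut02, ofGens_symm_of]; simp [aut02InvGen, PresentedGroup.of]
/-- `aut02⁻¹ b₁`. [folklore] -/
theorem aut02_symm_zb1 : aut02.toMulEquiv.symm (zb 1) = zb 1 * (za 1)⁻¹ := by
  rw [aut02, ofGens_symm_of]; simp [aut02InvGen, PresentedGroup.of]
/-- `aut02⁻¹ a₂`. [folklore] -/
theorem aut02_symm_za2 : aut02.toMulEquiv.symm (za 2) = za 2 * zb 2 * (za 2)⁻¹ := by
  rw [aut02, ofGens_symm_of]; simp [aut02InvGen, PresentedGroup.of, mul_assoc]
/-- `aut02⁻¹ b₂`. [folklore] -/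
theorem aut02_symm_zb2 : aut02.toMulEquiv.symm (zb 2) = (zb 2)⁻¹ * (za 2)⁻¹ := by
  rw [aut02, ofGens_symm_of]; simp [aut02InvGen, PresentedGroup.of]

/-- `aut12 a₀`. [folklore] -/
theorem aut12_za0 : aut12.toMulEquiv (za 0) = za 0 := by
  rw [aut12, ofGens_of]; simp [aut12Gen, PresentedGroup.of]
/-- `aut12 a₁`. [folklore] -/
theorem aut12_za1 : aut12.toMulEquiv (za 1) = (zb 1)⁻¹ := by
  rw [aut12, ofGens_of]; simp [aut12Gen, PresentedGroup.of]
/-- `aut12 b₁`. [folklore] -/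
theorem aut12_zb1 : aut12.toMulEquiv (zb 1) = zb 1 * za 1 := by
  rw [aut12, ofGens_of]; simp [aut12Gen, PresentedGroup.of]
/-- `aut12 a₂`. [folklore] -/
theorem aut12_za2 : aut12.toMulEquiv (za 2) = za 2 * zb 2 := by
  rw [aut12, ofGens_of]; simp [aut12Gen, PresentedGroup.of]
/-- `aut12 b₂`. [folklore] -/
theorem aut12_zb2 : aut12.toMulEquiv (zb 2) = zb 2 := by
  rw [aut12, ofGens_of]; simp [aut12Gen, PresentedGroup.of]
/-- `aut12⁻¹ a₀`. [folklore] -/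
theorem aut12_symm_za0 : aut12.toMulEquiv.symm (za 0) = za 0 := by
  rw [aut12, ofGens_symm_of]; simp [aut12InvGen, PresentedGroup.of]
/-- `aut12⁻¹ a₁`. [folklore] -/
theorem aut12_symm_za1 : aut12.toMulEquiv.symm (za 1) = za 1 * zb 1 := by
  rw [aut12, ofGens_symm_of]; simp [aut12InvGen, PresentedGroup.of]
/-- `aut12⁻¹ b₁`. [folklore] -/
theorem aut12_symm_zb1 : aut12.toMulEquiv.symm (zb 1) = (za 1)⁻¹ := by
  rw [aut12, ofGens_symm_of]; simp [aut12InvGen, PresentedGroup.of]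
/-- `aut12⁻¹ a₂`. [folklore] -/
theorem aut12_symm_za2 : aut12.toMulEquiv.symm (za 2) = za 2 * (zb 2)⁻¹ := by
  rw [aut12, ofGens_symm_of]; simp [aut12InvGen, PresentedGroup.of]
/-- `aut12⁻¹ b₂`. [folklore] -/
theorem aut12_symm_zb2 : aut12.toMulEquiv.symm (zb 2) = zb 2 := by
  rw [aut12, ofGens_symm_of]; simp [aut12InvGen, PresentedGroup.of]

/-- `N₀ = ⟪a₀,a₁,b₂⟫` in `za/zb` letters. [folklore] -/
theorem s4Kernels_zero_z : s4Kernels 0 = normalClosure {za 0, za 1, zb 2} := rfl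
/-- `N₁ = ⟪a₀,b₁,a₂⟫`. [folklore] -/
theorem s4Kernels_one_z : s4Kernels 1 = normalClosure {za 0, zb 1, za 2} := rfl

/-! ### The three standard pairs carried onto the pairs of `zKernels` -/

/-- `ρ₂ N₀ = Z₀ = ⟪a₀,a₁,a₂⟫`. [folklore] -/
theorem map_rot2_zero : (s4Kernels 0).map rot2.toMulEquiv.toMonoidHom = zKernels 0 := by
  rw [s4Kernels_zero_z, zKernels_zero]
  refine map_normalClosure_eq_of _ _ _ ?_ ?_
  · intro x hx
    simp only [Set.mem_insert_iff, Set.mem_singleton_iff] at hx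
    rcases hx with rfl | rfl | rfl
    · rw [rot2_za0]; exact subset_normalClosure (by simp)
    · rw [rot2_za1]; exact subset_normalClosure (by simp)
    · rw [rot2_zb2]; exact conj_mem_nc _ _ (subset_normalClosure (by simp))
  · intro y hy
    simp only [Set.mem_insert_iff, Set.mem_singleton_iff] at hy
    rcases hy with rfl | rfl | rfl
    · rw [rot2_symm_za0]; exact subset_normalClosure (by simp)
    · rw [rot2_symm_za1]; exact subset_normalClosure (by simp)
    · rw [rot2_symm_za2]; exact conj_mem_nc _ _ (subset_normalClosure (by simp))

/-- `ρ₂ N₁ = Z₁ = ⟪a₀,b₁,b₂⟫`. [folklore] -/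
theorem map_rot2_one : (s4Kernels 1).map rot2.toMulEquiv.toMonoidHom = zKernels 1 := by
  rw [s4Kernels_one_z, zKernels_one]
  refine map_normalClosure_eq_of _ _ _ ?_ ?_
  · intro x hx
    simp only [Set.mem_insert_iff, Set.mem_singleton_iff] at hx
    rcases hx with rfl | rfl | rfl
    · rw [rot2_za0]; exact subset_normalClosure (by simp)
    · rw [rot2_zb1]; exact subset_normalClosure (by simp)
    · rw [rot2_za2]; exact inv_mem (subset_normalClosure (by simp))
  · intro y hy
    simp only [Set.mem_insert_iff, Set.mem_singleton_iff] at hy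
    rcases hy with rfl | rfl | rfl
    · rw [rot2_symm_za0]; exact subset_normalClosure (by simp)
    · rw [rot2_symm_zb1]; exact subset_normalClosure (by simp)
    · rw [rot2_symm_zb2]; exact inv_mem (subset_normalClosure (by simp))

/-- `θ N₀ = Z₀`. [folklore] -/
theorem map_aut02_zero : (s4Kernels 0).map aut02.toMulEquiv.toMonoidHom = zKernels 0 := by
  rw [s4Kernels_zero_z, zKernels_zero]
  refine map_normalClosure_eq_of _ _ _ ?_ ?_
  · intro x hx
    simp only [Set.mem_insert_iff, Set.mem_singleton_iff] at hx
    rcases hx with rfl | rfl | rfl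
    · rw [aut02_za0]; exact subset_normalClosure (by simp)
    · rw [aut02_za1]; exact subset_normalClosure (by simp)
    · rw [aut02_zb2]; exact conj_mem_nc _ _ (subset_normalClosure (by simp))
  · intro y hy
    simp only [Set.mem_insert_iff, Set.mem_singleton_iff] at hy
    rcases hy with rfl | rfl | rfl
    · rw [aut02_symm_za0]; exact subset_normalClosure (by simp)
    · rw [aut02_symm_za1]; exact subset_normalClosure (by simp)
    · rw [aut02_symm_za2]; exact conj_mem_nc _ _ (subset_normalClosure (by simp))

/-- `θ N₁ = Z₂ = ⟪a₀, a₁b₁, a₂b₂⟫`. [folklore] -/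
theorem map_aut02_one : (s4Kernels 1).map aut02.toMulEquiv.toMonoidHom = zKernels 2 := by
  rw [s4Kernels_one_z, zKernels_two]
  refine map_normalClosure_eq_of _ _ _ ?_ ?_
  · intro x hx
    simp only [Set.mem_insert_iff, Set.mem_singleton_iff] at hx
    rcases hx with rfl | rfl | rfl
    · rw [aut02_za0]; exact subset_normalClosure (by simp)
    · rw [aut02_zb1]
      -- b₁a₁ = a₁⁻¹ (a₁b₁) a₁
      have h := conj_mem_nc' (za 1) (za 1 * zb 1)
        (subset_normalClosure (s := ({za 0, za 1 * zb 1, za 2 * zb 2} : Set (SurfaceGroup 3))) (by simp))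
      simpa [mul_assoc] using h
    · rw [aut02_za2]
      -- a₂⁻¹b₂⁻¹ = (b₂a₂)⁻¹, b₂a₂ = a₂⁻¹ (a₂b₂) a₂
      have h := conj_mem_nc' (za 2) (za 2 * zb 2)
        (subset_normalClosure (s := ({za 0, za 1 * zb 1, za 2 * zb 2} : Set (SurfaceGroup 3))) (by simp))
      have h' := inv_mem h
      simpa [mul_assoc] using h'
  · intro y hy
    simp only [Set.mem_insert_iff, Set.mem_singleton_iff] at hy
    rcases hy with rfl | rfl | rfl
    · rw [aut02_symm_za0]; exact subset_normalClosure (by simp)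
    · rw [map_mul, aut02_symm_za1, aut02_symm_zb1]
      -- a₁ · b₁ a₁⁻¹
      have h := conj_mem_nc (za 1) (zb 1)
        (subset_normalClosure (s := ({za 0, zb 1, za 2} : Set (SurfaceGroup 3))) (by simp))
      simpa [mul_assoc] using h
    · rw [map_mul, aut02_symm_za2, aut02_symm_zb2]
      -- (a₂ b₂ a₂⁻¹)(b₂⁻¹ a₂⁻¹) = a₂ · (b₂ a₂⁻¹ b₂⁻¹) · a₂⁻¹
      have ha : za 2 ∈ normalClosure ({za 0, zb 1, za 2} : Set (SurfaceGroup 3)) :=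
        subset_normalClosure (by simp)
      have h : za 2 * (zb 2 * (za 2)⁻¹ * (zb 2)⁻¹) * (za 2)⁻¹ ∈
          normalClosure ({za 0, zb 1, za 2} : Set (SurfaceGroup 3)) :=
        mul_mem (mul_mem ha (conj_mem_nc _ _ (inv_mem ha))) (inv_mem ha)
      simpa [mul_assoc] using h

/-- `λ N₀ = Z₁`. [folklore] -/
theorem map_aut12_zero : (s4Kernels 0).map aut12.toMulEquiv.toMonoidHom = zKernels 1 := by
  rw [s4Kernels_zero_z, zKernels_one]
  refine map_normalClosure_eq_of _ _ _ ?_ ?_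
  · intro x hx
    simp only [Set.mem_insert_iff, Set.mem_singleton_iff] at hx
    rcases hx with rfl | rfl | rfl
    · rw [aut12_za0]; exact subset_normalClosure (by simp)
    · rw [aut12_za1]; exact inv_mem (subset_normalClosure (by simp))
    · rw [aut12_zb2]; exact subset_normalClosure (by simp)
  · intro y hy
    simp only [Set.mem_insert_iff, Set.mem_singleton_iff] at hy
    rcases hy with rfl | rfl | rfl
    · rw [aut12_symm_za0]; exact subset_normalClosure (by simp)
    · rw [aut12_symm_zb1]; exact inv_mem (subset_normalClosure (by simp))
    · rw [aut12_symm_zb2]; exact subset_normalClosure (by simp)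

/-- `λ N₁ = Z₂`. [folklore] -/
theorem map_aut12_one : (s4Kernels 1).map aut12.toMulEquiv.toMonoidHom = zKernels 2 := by
  rw [s4Kernels_one_z, zKernels_two]
  refine map_normalClosure_eq_of _ _ _ ?_ ?_
  · intro x hx
    simp only [Set.mem_insert_iff, Set.mem_singleton_iff] at hx
    rcases hx with rfl | rfl | rfl
    · rw [aut12_za0]; exact subset_normalClosure (by simp)
    · rw [aut12_zb1]
      have h := conj_mem_nc' (za 1) (za 1 * zb 1)
        (subset_normalClosure (s := ({za 0, za 1 * zb 1, za 2 * zb 2} : Set (SurfaceGroup 3))) (by simp))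
      simpa [mul_assoc] using h
    · rw [aut12_za2]; exact subset_normalClosure (by simp)
  · intro y hy
    simp only [Set.mem_insert_iff, Set.mem_singleton_iff] at hy
    rcases hy with rfl | rfl | rfl
    · rw [aut12_symm_za0]; exact subset_normalClosure (by simp)
    · rw [map_mul, aut12_symm_za1, aut12_symm_zb1]
      have h := conj_mem_nc (za 1) (zb 1)
        (subset_normalClosure (s := ({za 0, zb 1, za 2} : Set (SurfaceGroup 3))) (by simp))
      simpa [mul_assoc] using h
    · rw [map_mul, aut12_symm_za2, aut12_symm_zb2]
      have ha : za 2 ∈ normalClosure ({za 0, zb 1, za 2} : Set (SurfaceGroup 3)) :=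
        subset_normalClosure (by simp)
      simpa using ha

/-- PAIR `(0,1)`: `ρ₂ (N₀, N₁) = (Z₀, Z₁)`. [folklore] -/
theorem pair01_zKernels : ∃ α : SurfaceGroup 3 ≃* SurfaceGroup 3,
    (s4Kernels 0).map α.toMonoidHom = zKernels 0 ∧ (s4Kernels 1).map α.toMonoidHom = zKernels 1 :=
  ⟨rot2.toMulEquiv, map_rot2_zero, map_rot2_one⟩

/-- PAIR `(0,2)`: `θ ∘ (cyc ∘ swp)` carries `(N₀, N₂)` to `(Z₀, Z₂)` (the slot symmetry
`swp.trans cyc` realises the transposition `N₁ ↔ N₂` fixing `N₀`). [folklore] -/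
theorem pair02_zKernels : ∃ α : SurfaceGroup 3 ≃* SurfaceGroup 3,
    (s4Kernels 0).map α.toMonoidHom = zKernels 0 ∧ (s4Kernels 2).map α.toMonoidHom = zKernels 2 := by
  refine ⟨((swp.trans cyc).trans aut02).toMulEquiv, ?_, ?_⟩
  · rw [map_toMulEquiv_trans, map_toMulEquiv_trans, map_swp_zero, map_cyc_one, map_aut02_zero]
  · rw [map_toMulEquiv_trans, map_toMulEquiv_trans, map_swp_two, map_cyc_two, map_aut02_one]

/-- PAIR `(1,2)`: `λ ∘ cyc` carries `(N₁, N₂)` to `(Z₁, Z₂)` (`cyc : N₁ ↦ N₀, N₂ ↦ N₁`).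
[folklore] -/
theorem pair12_zKernels : ∃ α : SurfaceGroup 3 ≃* SurfaceGroup 3,
    (s4Kernels 1).map α.toMonoidHom = zKernels 1 ∧ (s4Kernels 2).map α.toMonoidHom = zKernels 2 := by
  refine ⟨(cyc.trans aut12).toMulEquiv, ?_, ?_⟩
  · rw [map_toMulEquiv_trans, map_cyc_one, map_aut12_zero]
  · rw [map_toMulEquiv_trans, map_cyc_two, map_aut12_one]

/-- **The `(3,1)` trisection `zKernels` of `S¹×S³ # ℂP² # ℂP²` is in WALDHAUSEN NORMAL FORM**:
each of its three ordered Heegaard pairs is the image of the corresponding standard pair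
`(N_i, N_j)` of the genus-3 trisection of `S⁴` under ONE automorphism of `S_3`. [folklore] -/
theorem pairs_zKernels (i j : Fin 3) (hij : i ≠ j) :
    ∃ α : SurfaceGroup 3 ≃* SurfaceGroup 3,
      (s4Kernels i).map α.toMonoidHom = zKernels i ∧ (s4Kernels j).map α.toMonoidHom = zKernels j := by
  have key : ∀ i j : Fin 3, i < j → ∃ α : SurfaceGroup 3 ≃* SurfaceGroup 3,
      (s4Kernels i).map α.toMonoidHom = zKernels i ∧ (s4Kernels j).map α.toMonoidHom = zKernels j := by
    intro i j h
    fin_cases i <;> fin_cases j <;>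
      first
      | exact absurd h (by decide)
      | exact pair01_zKernels
      | exact pair02_zKernels
      | exact pair12_zKernels
  rcases lt_or_gt_of_ne hij with h | h
  · exact key i j h
  · obtain ⟨α, h1, h2⟩ := key j i h
    exact ⟨α, h2, h1⟩


end Summit.SmoothPoincare4.SmoothPoincare4.Theorems.NormalFormStablyTrivial.Negative

end
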